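import Literature.MathematicalPhysics.QuantumFieldTheory.Balaban1983to89.B9SectCDiffCutModelToy5

/-!
# `Balaban1983to89.B9SectCDiffCutModelToy6` — towards the COARSE side of the one-level toy: the Woodbury skeleton
`G₀ = (∂∂* + μ)⁻¹` as the reversal conjugate of Toy5's `G′` (with its classes `𝒟(0, 2, 4e^{1/2})`, `∂*G₀ ∈
𝒟(0, 1, 4e)`), the coarse-inverse ENGINE (an exponentially weighted row bound `< 1` for `1 − D⁻¹E` ⇒ `E` invertible
with exponentially weighted row bounds for `E⁻¹`, by a finite maximum argument on the exact identity
`(1 − M)⁻¹ = 1 + M(1 − M)⁻¹` — no Neumann series), its packaging into the class `𝒟(0, k, c)` of the toy frame, and the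
first LOWER bound of the programme: an explicit block SUBsolution for `H_μ` giving the within-block mass
`Σ_{x,z ∈ I} G′(x,z) ≥ μ⁻¹·(B − 2/(1 − e^{−t}))` (census `b2b-balaban-r1/SectC-inst-census.md` §6 (a⁵), second half,
part 1; notes N11–N12), together with the coarse operator `E₂ = Q′G′²Q′*` and its diagonal lower bound
`E₂(I,I) ≥ (Σ_{x∈I}(G′𝟙_I)(x))²/B²`

B9 = T. Bałaban, *Propagators for lattice gauge theories in a background field*, Commun. Math. Phys. **99**, 389–434
(1985) [Balaban1985BackgroundPropagators].

CITATION HEADER (lean-in-tree rule 2026-08-18).  Cell `pub-balaban`, unit `b2b-balaban-r1-g16` (READER GROUP A,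
lineage r1, gen 16, third leaf), journal claim `SECTC-DIFF-CUTMODEL-TOY6`.  Source: doi:10.1007/bf01240355, held
`paper:balaban1985-cmp99-background-propagators`, journal page = PDF page + 388.  This unit re-read NO page and
introduces NO quotation: the field SHAPES inhabited in §3 — `MOne.mG` / `MTwo.mG : OpDec F bb bb p p 0 2 c G` and
`MTwo.mDtG : OpDec F bs bb p p 0 1 c (∂*·G)` of `…B9SectCDiffAssembly` — carry the scale powers of B9's Theorem 3.1
(3.42), p. 397 [PDF 9], and the target shape of §5 — `MOne.mC : OpDec F bS bS p p 0 (−4) c C` — that of Theorem 3.2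
(3.48), p. 398 [PDF 10]; both sentences are quoted VERBATIM in the headers of `…B9SectCDiffEstimate` /
`…B9SectCDiffAssembly`, and the present declarations point to those quotations BY NAME only.  Tree inputs (by name):
`B9SectCDiffEstimate.{Frame, Frame.rate_zero, BlkMaj, WDec, OpDec}`, `B4Sect5Torus.IsPseudoDist` (via
`B9SectCDiffCutModelToy.bdist_isPseudoDist`), `B9SectCDiffCutModelToy.{bdist, bdist_nonneg, bdist_self, Qp}`, `B9SectCDiffCutModelToy2.Qpt`,
`B9SectCDiffCutModelToy3.{toyFrame, toyFrame_ρ, toyFrame_sc, toyFrame_δ₀}`, `B9SectCDiffCutModelToy4.{ι, ι_eq, Sh,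
Sh_apply, Sh_transpose… (via Dfw/Dbw), sum_Sh_mul, sum_mul_Sh, Dfw, Dbw}`, `B9SectCDiffCutModelToy5.{Hm, Hm_mulVec,
Gr, isDomZ_Hm, IsDomZ.nonneg_of_mulVec_nonneg, IsDomZ.mul_inv, Hm_mul_Gr, Gr_nonneg, Gr_transpose, Gr_mass_le,
Gr_block_rowsum, DGr_entry_le, DGr_block_rowsum, three_term_nonneg, three_term_nonneg', card_block_le}`; Mathlib's
non-singular-inverse API (`Matrix.mulVec_injective_iff_isUnit`, `Matrix.isUnit_iff_isUnit_det`,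
`Matrix.mul_nonsing_inv`, `Matrix.nonsing_inv_mul`, `Matrix.inv_eq_left_inv`, `Matrix.isUnit_det_of_left_inverse`,
`Matrix.inv_submatrix_equiv`), `Fin.revPerm`, `geom_sum_mul_neg`, `sq_sum_le_card_mul_sum_sq` otherwise.  Cell rows: GAPS C-r1g13-1 (the cut
model), C-r1g14-1 … C-r1g16-2 (the toys 1–5), this module's row C-r1g16-3; census §6 (a⁵) / notes N10–N12.  No
`HarnessLib` fact, no named-fact `Prop`, no `instance`; two Prop-valued predicates (`IsWt` on weights, `RowLe` on
matrices — hypotheses of the engine, never assumed about a tree object: `IsWt` is PROVED for the exponential block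
weight in `isWt_ewt`); no `sorry`.

## WHAT THIS MODULE DOES

Toy5 (gen 16, second leaf) settled the inverse side for `G′ = (∂*∂ + B⁻²)⁻¹` and `∂G′`.  Census note N11 lists what a
cut-model / `EstHyp` instance with `∂ ≠ 0` on the toy still needs on the inverse side: the sequence datum `G` and the
coarse operator `C = (Q′G′²Q′*)⁻¹ ∈ 𝒟(0, −4, c)`.  CORRECTION of the phrase "`G = (m′² + ∂∂*)⁻¹` (the same engine
with the boundary rows exchanged)" in Toy5's header / census N10: the cut model's `G` inverts
`Λ + A + ∂(1 − P)∂*` with `P = G′Q′*CQ′G′` (`TwoSeq.hG₁`), NOT `Λ + ∂∂*`; for `Λ = λ·1`, `A = 0` the push-through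
identity `1 − ∂*(λ + ∂∂*)⁻¹∂ = λ(λ + ∂*∂)⁻¹` gives the Woodbury form `G = G₀ + G₀∂G′Q′*·(λE₃)⁻¹·Q′G′∂*G₀` with
`G₀ = (λ + ∂∂*)⁻¹`, `E₃ = Q′G′(λ + ∂*∂)⁻¹G′Q′*` — so `G` needs, besides the skeleton `G₀`, a SECOND coarse inverse
of the same type as `C = E₂⁻¹`, `E₂ = Q′G′²Q′*`.  This leaf provides the skeleton, the engine that will invert
`E₂`, `E₃` once their weighted diagonal dominance is established, and the lower bound that starts that verification:

* §1–§2 the order-reversing permutation `rev : (I, o) ↦ (n−1−I, B−1−o)` of the toy line (`ι ∘ rev = nB − 1 − ι`: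
  `ι_rev`; `|ι(rev x) − ι(rev y)| = |ι x − ι y|`: `dι_rev`) conjugates the shift into its transpose
  (`Sh_submatrix`) hence `∂` into `∂*` (`Dfw_submatrix`, `Dbw_submatrix`) and `H₀ := ∂∂* + μ` into Toy5's
  `H_μ = ∂*∂ + μ` (`Hd_submatrix`); therefore **`G₀ := H₀⁻¹` is `G′` read backwards** (`Gr_eq_submatrix`, `Gd_apply :
  G₀(x, y) = G′(rev x, rev y)`), and ALL of Toy5 transfers for free: `H₀G₀ = 1` (`Hd_mul_Gd`), `G₀ ≥ 0`, symmetry,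
  the pointwise bound `G₀(x,y) ≤ (4/m)e^{−(m/2)|ι x − ι y|}` (`Gd_mass_le`), `∂*G₀ = rev-conjugate of ∂G′`
  (`Dbw_mul_Gd`) with `|(∂*G₀)(x,y)| ≤ 4e^{1/2}e^{−|ι x − ι y|/(2B)}` at `m = 1/B` (`DtGd_entry_le`);
* §3 **`Gd_opDec : G₀ ∈ 𝒟(0, 2, 4e^{1/2})`** and **`DtGd_opDec : ∂*G₀ ∈ 𝒟(0, 1, 4e)`** on the toy frame
  (`δ₀ ≤ 1/2`, mass `1/B`) — the SHAPES `mG`, `mDtG`, constants free of `B`, `n`, `N`;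
* §4 THE ENGINE, over any finite index type: a weight `w ≥ 1` with `w(i,i) = 1`, `w(i,k) ≤ w(i,j)w(j,k)` (`IsWt`)
  and the weighted row bound `RowLe w M q : Σ_j |M(i,j)|w(i,j) ≤ q`; then `RowLe` is submultiplicative
  (`RowLe.mul`), contracts `ℓ^∞` (`abs_mulVec_le`), `q < 1` makes `1 − M` injective hence invertible
  (`one_sub_mulVec_injective`, `isUnit_one_sub` — a largest `|v_i|` cannot be reproduced by `Mv`), and **`inv_one_sub
  : RowLe w (1 − M)⁻¹ (1 − q)⁻¹`** (read `X = 1 + MX` at a row of largest weighted sum, using the supermultiplicativity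
  of `w`); with a diagonal `D ≥ d > 0`, **`inv_of_diag`: `RowLe w (1 − D⁻¹E) q`, `q < 1` ⇒ `IsUnit E ∧ RowLe w E⁻¹
  ((1 − q)⁻¹d⁻¹)`**, i.e. `|E⁻¹(i,j)| ≤ e^{−κ·dist(i,j)}/((1 − q)d)` for `w = e^{κ·dist}` (`entry_mul_le`);
* §5 the exponential block weight `ewt κ (I, J) = e^{κ|I−J|}` is such a weight (`isWt_ewt`, from
  `bdist_isPseudoDist`), and **`opDec_coarse_of_rowLe`: `RowLe (ewt κ) C R`, `0 ≤ κ`, `δ₀ ≤ κ`, `R ≤ c·B^k` ⇒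
  `C ∈ 𝒟(0, k, c)`** on the toy frame with unit coarse blocks — the exact shape of the field `mC` (`k = −4`);
* §6 the LOWER-bound tool the engine's hypothesis requires (Toy5 has only upper bounds): the subsolution comparison
  `Aψ ≤ f ⇒ ψ ≤ A⁻¹f` for dominant Z-matrices (`IsDomZ.le_inv_mulVec_of_subsol`), the block profile
  `θ(o) = 1 − (e^{−to} + e^{−t(B−1−o)})/(1 + e^{−t(B−1)})` (`bprof`: `= 0` at both ends of the block, `0 ≤ θ ≤ 1`,
  `θ ≥ 1 − e^{−to} − e^{−t(B−1−o)}`, and `(2+μ)θ(o) − θ(o−1) − θ(o+1) ≤ μ` whenever `e^t + e^{−t} ≤ 2 + μ`: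
  `bprof_three_term`, from Toy5's `three_term_nonneg`), the block subsolution `ψ_I = μ⁻¹θ𝟙_I` with
  **`Hm_mulVec_psi_le : H_μψ_I ≤ 𝟙_I`**, hence **`psi_le_Gr_block : (G′𝟙_I)(x) ≥ μ⁻¹θ(o(x))` on `I`** and, summing
  the boundary layers geometrically (`sum_exp_neg_le`), **`blockMass_ge : Σ_{x∈I}(G′𝟙_I)(x) ≥ μ⁻¹(B − 2/(1 −
  e^{−t}))`** — at `μ = m²`, `t = m/2`, `m = a/B`: `(B³/a²)(1 − O(1/a))`, so that `E₂(I,I) ≥ (Σ_{x∈I}G′𝟙_I)²/B² ≳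
  B⁴/a⁴` dominates the off-diagonal row mass `O(B⁴/a⁵)` for an absolute `a` — the plan recorded in census N12;
* §7 the coarse operator itself, **`E2 := Qp·(G′·G′)·Qpt`** (`E2_apply : E₂(I,J) = B⁻¹Σ_{x∈I}Σ_{z∈J}(G′²)(x,z)`), and
  HALF of the engine's dominance hypothesis — the diagonal from below: **`E2_diag_ge_sq : E₂(I,I) ≥ (Σ_{x∈I}
  (G′𝟙_I)(x))²/B²`** (drop the sites `w ∉ I` of `G′² = Σ_w G′(·,w)G′(w,·)` by positivity, symmetry `Gr_symm`,
  Cauchy–Schwarz `sq_sum_le_card_mul_sum_sq` over the `≤ B` sites of the block) and **`E2_diag_ge : E₂(I,I) ≥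
  μ⁻²(B − 2/(1 − e^{−t}))²/B²`** for `e^t + e^{−t} ≤ 2 + μ`, `t > 0`, `B ≥ 2/(1 − e^{−t})`.

## WHAT IS NOT CLAIMED (ABSOLUTE RULE)

Nothing printed is asserted.  Everything here is finite-dimensional linear algebra and the one-dimensional discrete
Helmholtz equation on a path (folklore); B9's Theorems 3.1–3.3 concern gauge-covariant operators in a background
field on a four-dimensional multi-level lattice, and nothing here bears on them or on their printed proofs — in
particular the engine of §4 is the GENERIC weighted-`ℓ^∞` inversion lemma, not B9's (3.47)–(3.61) argument, and it is
stated with its dominance hypothesis EXPLICIT (`RowLe w (1 − D⁻¹E) q`, `q < 1`), proved about no tree object yet.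
NOT done (census §6 (a⁵), second half, parts 2–3; note N12): the other half of that hypothesis for `E₂ = Q′G′²Q′*`
— the off-diagonal weighted row mass from ABOVE (from `Gr_mass_le` by a triple geometric convolution; expected
`≤ C₂B⁴/a⁵` at mass `a/B`, so that `inv_of_diag` applies for `a ≥ a₀` absolute, `B ≥ a`) —, the same two bounds for
`E₃`, hence `C ∈ 𝒟(0, −4, c(a₀))`; the Woodbury /
push-through algebra for `G` as matrices; the packaging with Toy4's Leibniz block and gen 15's Q-records into a
`TwoSeq` / `CutModel` / `EstHyp` instance with `∂ ≠ 0`; an `n`-free majorant profile.  The constants `4e^{1/2}`, `4e`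
and the rate `1/2` per block are inherited from Toy5 unoptimised; `toyFrame` is reused as typed in gen 15.  Value =
kernel certificates (the skeleton classes, the inversion engine, the first lower bound) and a precise typed plan for
the coarse inverse — NOT summit progress.
-/

namespace Literature.MathematicalPhysics.QuantumFieldTheory.Balaban1983to89.B9SectCDiffCutModelToy6

open Finset Real
open B9SectCDiffEstimate
open B9SectCDiffCutModel
open B9SectCDiffCutModelToy
open B9SectCDiffCutModelToy2
open B9SectCDiffCutModelToy3
open B9SectCDiffCutModelToy4
open B9SectCDiffCutModelToy5

noncomputable section

/-! ## §1 The order-reversing permutation of the toy line -/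

section Rev

variable {n B : ℕ}

/-- the order-reversing permutation of the toy line: `(I, o) ↦ (n−1−I, B−1−o)`, i.e. `ι ↦ nB − 1 − ι`.
OURS (typing). [folklore] -/
def rev : Fin n × Fin B ≃ Fin n × Fin B := Equiv.prodCongr Fin.revPerm Fin.revPerm

/-- [folklore] -/
theorem rev_apply (x : Fin n × Fin B) : rev x = (x.1.rev, x.2.rev) := rfl

/-- [folklore] -/
@[simp] theorem rev_rev (x : Fin n × Fin B) : rev (rev x) = x := by
  rw [rev_apply, rev_apply]; exact Prod.ext (Fin.rev_rev _) (Fin.rev_rev _)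

/-- `ι (rev x) = nB − 1 − ι x`. [folklore] -/
theorem ι_rev (x : Fin n × Fin B) : ι (rev x) + ι x + 1 = n * B := by
  rw [ι_eq, ι_eq, rev_apply]
  simp only [Fin.val_rev]
  have ha : x.1.val + 1 ≤ n := x.1.isLt
  have ho : x.2.val + 1 ≤ B := x.2.isLt
  zify [ha, ho]
  ring

/-- [folklore] -/
theorem ι_rev_real (x : Fin n × Fin B) : (ι (rev x) : ℝ) = (n : ℝ) * B - 1 - ι x := by
  have h := ι_rev x
  have h' : ((ι (rev x) + ι x + 1 : ℕ) : ℝ) = ((n * B : ℕ) : ℝ) := by rw [h]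
  push_cast at h'
  linarith

/-- reversal preserves linear distances. [folklore] -/
theorem dι_rev (x y : Fin n × Fin B) : |(ι (rev x) : ℝ) - ι (rev y)| = |(ι x : ℝ) - ι y| := by
  rw [ι_rev_real, ι_rev_real, show (n : ℝ) * B - 1 - ι x - ((n : ℝ) * B - 1 - ι y) = (ι y : ℝ) - ι x by ring,
    abs_sub_comm]

/-- reversal turns the forward shift into the backward shift: `S(rev x, rev y) = S(y, x)`. [folklore] -/
theorem Sh_rev (x y : Fin n × Fin B) : Sh n B (rev x) (rev y) = Sh n B y x := by
  rw [Sh_apply, Sh_apply]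
  have h1 := ι_rev x
  have h2 := ι_rev y
  by_cases h : ι x = ι y + 1
  · rw [if_pos h, if_pos (by omega)]
  · rw [if_neg h, if_neg (by omega)]

/-- `R S R = Sᵀ`. [folklore] -/
theorem Sh_submatrix : (Sh n B).submatrix rev rev = (Sh n B).transpose := by
  ext x y; rw [Matrix.submatrix_apply, Matrix.transpose_apply, Sh_rev]

/-- `R ∂ R = ∂*` (for the toy's `∂ = S − 1`, `∂* = Sᵀ − 1`). [folklore] -/
theorem Dfw_submatrix : (Dfw n B).submatrix rev rev = Dbw n B := by
  unfold Dfw Dbw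
  rw [Matrix.submatrix_sub, Pi.sub_apply, Pi.sub_apply, Sh_submatrix, Matrix.submatrix_one_equiv]

/-- `R ∂* R = ∂`. [folklore] -/
theorem Dbw_submatrix : (Dbw n B).submatrix rev rev = Dfw n B := by
  unfold Dfw Dbw
  rw [Matrix.submatrix_sub, Pi.sub_apply, Pi.sub_apply, ← Matrix.transpose_submatrix, Sh_submatrix,
    Matrix.transpose_transpose, Matrix.submatrix_one_equiv]

end Rev

/-! ## §2 `H₀ = ∂∂* + μ` and the Woodbury skeleton `G₀ = H₀⁻¹` as reversal conjugates of Toy5's `H_μ`, `G′` -/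

section Dual

variable {n B : ℕ}

/-- `H₀ := ∂∂* + μ·1 = 2·1 − E_last − S − Sᵀ + μ·1` — the operator of the Woodbury skeleton `G₀ = (μ + ∂∂*)⁻¹`
of the sequence datum `G` (header), Toy5's `H_μ = ∂*∂ + μ` with the boundary rows exchanged. OURS (typing).
[folklore] -/
def Hd (n B : ℕ) (μ : ℝ) : Matrix (Fin n × Fin B) (Fin n × Fin B) ℝ :=
  Dfw n B * Dbw n B + μ • (1 : Matrix (Fin n × Fin B) (Fin n × Fin B) ℝ)

/-- `R H₀ R = H_μ`. [folklore] -/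
theorem Hd_submatrix (μ : ℝ) : (Hd n B μ).submatrix rev rev = Hm n B μ := by
  unfold Hd Hm
  rw [Matrix.submatrix_add, Pi.add_apply, Pi.add_apply, ← Matrix.submatrix_mul_equiv _ _ _ rev _, Dfw_submatrix,
    Dbw_submatrix, Matrix.submatrix_smul, Pi.smul_apply, Pi.smul_apply, Matrix.submatrix_one_equiv]

/-- `G₀ := H₀⁻¹ = (∂∂* + μ)⁻¹`, the Woodbury skeleton. OURS (typing). [folklore] -/
def Gd (n B : ℕ) (μ : ℝ) : Matrix (Fin n × Fin B) (Fin n × Fin B) ℝ := (Hd n B μ)⁻¹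

/-- `R G′ R = G₀`: `G′ = (R H₀ R)⁻¹ = R H₀⁻¹ R`. [folklore] -/
theorem Gr_eq_submatrix (μ : ℝ) : Gr n B μ = (Gd n B μ).submatrix rev rev := by
  unfold Gr Gd; rw [← Hd_submatrix, Matrix.inv_submatrix_equiv]

/-- `G₀(x, y) = G′(rev x, rev y)`. [folklore] -/
theorem Gd_apply (μ : ℝ) (x y : Fin n × Fin B) : Gd n B μ x y = Gr n B μ (rev x) (rev y) := by
  rw [Gr_eq_submatrix, Matrix.submatrix_apply, rev_rev, rev_rev]

/-- [folklore] -/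
theorem Gd_eq_submatrix (μ : ℝ) : Gd n B μ = (Gr n B μ).submatrix rev rev := by
  ext x y; rw [Matrix.submatrix_apply, Gd_apply]

/-- `H·G = 1` for `μ > 0`. [folklore] -/
theorem Hd_mul_Gd {μ : ℝ} (hμ : 0 < μ) : Hd n B μ * Gd n B μ = 1 := by
  have h : (Hd n B μ * Gd n B μ).submatrix rev rev = (1 : Matrix (Fin n × Fin B) (Fin n × Fin B) ℝ) := by
    rw [← Matrix.submatrix_mul_equiv _ _ _ rev _, Hd_submatrix, ← Gr_eq_submatrix, Hm_mul_Gr hμ]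
  have h2 : ((Hd n B μ * Gd n B μ).submatrix rev rev).submatrix rev rev
      = (1 : Matrix (Fin n × Fin B) (Fin n × Fin B) ℝ).submatrix rev rev := by rw [h]
  rw [Matrix.submatrix_one_equiv, Matrix.submatrix_submatrix] at h2
  rw [← h2]
  ext x y
  simp only [Matrix.submatrix_apply, Function.comp, rev_rev]

/-- `G₀ ≥ 0` entrywise. [folklore] -/
theorem Gd_nonneg {μ : ℝ} (hμ : 0 < μ) (x y : Fin n × Fin B) : 0 ≤ Gd n B μ x y := by
  rw [Gd_apply]; exact Gr_nonneg hμ _ _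

/-- `G₀` is symmetric. [folklore] -/
theorem Gd_transpose (μ : ℝ) : (Gd n B μ).transpose = Gd n B μ := by
  ext x y; rw [Matrix.transpose_apply, Gd_apply, Gd_apply, ← Matrix.transpose_apply (Gr n B μ), Gr_transpose]

/-- THE POINTWISE BOUND for `G₀`: `0 ≤ G₀(x, y) ≤ (4/m)·e^{−(m/2)|ι x − ι y|}` (`μ = m²`, `0 < m ≤ 1`). [folklore] -/
theorem Gd_mass_le {m : ℝ} (hm0 : 0 < m) (hm1 : m ≤ 1) (x y : Fin n × Fin B) :
    Gd n B (m ^ 2) x y ≤ 4 / m * Real.exp (-(m / 2 * |(ι x : ℝ) - ι y|)) := by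
  rw [Gd_apply, ← dι_rev x y]; exact Gr_mass_le hm0 hm1 _ _

/-- `∂*·G = R (∂G′) R`. [folklore] -/
theorem Dbw_mul_Gd (μ : ℝ) : Dbw n B * Gd n B μ = (Dfw n B * Gr n B μ).submatrix rev rev := by
  rw [← Matrix.submatrix_mul_equiv _ _ _ rev _, Dfw_submatrix, ← Gd_eq_submatrix]

/-- THE POINTWISE BOUND for `∂*G₀` at mass `1/B`: `|(∂*G₀)(x, y)| ≤ 4e^{1/2}·e^{−|ι x − ι y|/(2B)}`. [folklore] -/
theorem DtGd_entry_le (hB : 0 < B) (x y : Fin n × Fin B) :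
    |(Dbw n B * Gd n B ((B : ℝ)⁻¹ ^ 2)) x y|
      ≤ 4 * Real.exp (1 / 2) * Real.exp (-((B : ℝ)⁻¹ / 2 * |(ι x : ℝ) - ι y|)) := by
  rw [Dbw_mul_Gd, Matrix.submatrix_apply, ← dι_rev x y]; exact DGr_entry_le hB _ _

end Dual

/-! ## §3 The block forms: `G₀ ∈ 𝒟(0, 2, 4e^{1/2})`, `∂*G₀ ∈ 𝒟(0, 1, 4e)` on the toy frame -/

section Block

variable {n B : ℕ} {N : Finset (Fin n)} {hN : N.Nonempty} {δ₀ : ℝ}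

/-- block row sums of `G₀` at mass `1/B`. [folklore] -/
theorem Gd_block_rowsum (hB : 0 < B) (x : Fin n × Fin B) (J : Fin n) :
    ∑ y ∈ univ.filter (fun y : Fin n × Fin B => y.1 = J), |Gd n B (((B : ℝ)⁻¹) ^ 2) x y|
      ≤ 4 * Real.exp (1 / 2) * (B : ℝ) ^ 2 * Real.exp (-(1 / 2 * bdist n x.1 J)) := by
  have hB' : (0 : ℝ) < B := by exact_mod_cast hB
  have hB1 : (1 : ℝ) ≤ B := by exact_mod_cast hB
  have hm0 : (0 : ℝ) < (B : ℝ)⁻¹ := inv_pos.mpr hB'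
  have hm1 : (B : ℝ)⁻¹ ≤ 1 := inv_le_one_of_one_le₀ hB1
  have hμ : (0 : ℝ) < ((B : ℝ)⁻¹) ^ 2 := by positivity
  have hterm : ∀ y ∈ univ.filter (fun y : Fin n × Fin B => y.1 = J),
      |Gd n B (((B : ℝ)⁻¹) ^ 2) x y| ≤ 4 * (B : ℝ) * (Real.exp (1 / 2) * Real.exp (-(1 / 2 * bdist n x.1 J))) := by
    intro y hy
    rw [mem_filter] at hy
    rw [abs_of_nonneg (Gd_nonneg hμ x y), ← hy.2]
    calc Gd n B (((B : ℝ)⁻¹) ^ 2) x y ≤ 4 / (B : ℝ)⁻¹ * Real.exp (-((B : ℝ)⁻¹ / 2 * |(ι x : ℝ) - ι y|)) :=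
          Gd_mass_le hm0 hm1 x y
      _ ≤ 4 / (B : ℝ)⁻¹ * (Real.exp (1 / 2) * Real.exp (-(1 / 2 * bdist n x.1 y.1))) :=
          mul_le_mul_of_nonneg_left (site_factor_le hB x y) (by positivity)
      _ = 4 * (B : ℝ) * (Real.exp (1 / 2) * Real.exp (-(1 / 2 * bdist n x.1 y.1))) := by
          rw [div_inv_eq_mul]
  have hcard := card_block_le (n := n) (B := B) J
  calc ∑ y ∈ univ.filter (fun y : Fin n × Fin B => y.1 = J), |Gd n B (((B : ℝ)⁻¹) ^ 2) x y|
      ≤ ∑ y ∈ univ.filter (fun y : Fin n × Fin B => y.1 = J),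
          4 * (B : ℝ) * (Real.exp (1 / 2) * Real.exp (-(1 / 2 * bdist n x.1 J))) := sum_le_sum hterm
    _ = (univ.filter (fun y : Fin n × Fin B => y.1 = J)).card
          * (4 * (B : ℝ) * (Real.exp (1 / 2) * Real.exp (-(1 / 2 * bdist n x.1 J)))) := by
        rw [sum_const, nsmul_eq_mul]
    _ ≤ (B : ℝ) * (4 * (B : ℝ) * (Real.exp (1 / 2) * Real.exp (-(1 / 2 * bdist n x.1 J)))) :=
        mul_le_mul_of_nonneg_right (by exact_mod_cast hcard) (by positivity)
    _ = _ := by ring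

/-- THE `(M)`-FIELD SHAPE `mG`, for the skeleton: at mass `1/B`, `G₀ = (∂∂* + B⁻²)⁻¹ ∈ 𝒟(0, 2, 4e^{1/2})` on the
toy frame (`δ₀ ≤ 1/2`), with a `B`-, `n`-, `N`-free constant. [folklore] -/
theorem Gd_opDec (hB : 0 < B) (hδ : δ₀ ≤ 1 / 2) :
    OpDec (toyFrame n B N hN δ₀) Prod.fst Prod.fst id id 0 2 (4 * Real.exp (1 / 2))
      (Gd n B (((B : ℝ)⁻¹) ^ 2)) := by
  refine ⟨fun I J => 4 * Real.exp (1 / 2) * (B : ℝ) ^ 2 * Real.exp (-(δ₀ * bdist n I J)), ⟨?_, ?_⟩, ?_⟩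
  · intro I J; positivity
  · intro x J
    refine (Gd_block_rowsum hB x J).trans ?_
    refine mul_le_mul_of_nonneg_left (Real.exp_le_exp.mpr ?_) (by positivity)
    nlinarith [bdist_nonneg (n := n) x.1 J]
  · intro I J
    simp only [toyFrame_ρ, toyFrame_sc, Frame.rate_zero, toyFrame_δ₀, id]
    rw [abs_of_nonneg (by positivity)]
    norm_cast

/-- block row sums of `∂*G₀` at mass `1/B`. [folklore] -/
theorem DtGd_block_rowsum (hB : 0 < B) (x : Fin n × Fin B) (J : Fin n) :
    ∑ y ∈ univ.filter (fun y : Fin n × Fin B => y.1 = J), |(Dbw n B * Gd n B ((B : ℝ)⁻¹ ^ 2)) x y|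
      ≤ 4 * Real.exp 1 * (B : ℝ) * Real.exp (-(1 / 2 * bdist n x.1 J)) := by
  have hee : Real.exp (1 / 2) * Real.exp (1 / 2) = Real.exp 1 := by rw [← Real.exp_add]; norm_num
  have hterm : ∀ y ∈ univ.filter (fun y : Fin n × Fin B => y.1 = J),
      |(Dbw n B * Gd n B ((B : ℝ)⁻¹ ^ 2)) x y| ≤ 4 * Real.exp 1 * Real.exp (-(1 / 2 * bdist n x.1 J)) := by
    intro y hy
    rw [mem_filter] at hy
    rw [← hy.2]
    calc |(Dbw n B * Gd n B ((B : ℝ)⁻¹ ^ 2)) x y|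
        ≤ 4 * Real.exp (1 / 2) * Real.exp (-((B : ℝ)⁻¹ / 2 * |(ι x : ℝ) - ι y|)) := DtGd_entry_le hB x y
      _ ≤ 4 * Real.exp (1 / 2) * (Real.exp (1 / 2) * Real.exp (-(1 / 2 * bdist n x.1 y.1))) :=
          mul_le_mul_of_nonneg_left (site_factor_le hB x y) (by positivity)
      _ = 4 * Real.exp 1 * Real.exp (-(1 / 2 * bdist n x.1 y.1)) := by rw [← hee]; ring
  have hcard := card_block_le (n := n) (B := B) J
  calc ∑ y ∈ univ.filter (fun y : Fin n × Fin B => y.1 = J), |(Dbw n B * Gd n B ((B : ℝ)⁻¹ ^ 2)) x y|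
      ≤ ∑ y ∈ univ.filter (fun y : Fin n × Fin B => y.1 = J),
          4 * Real.exp 1 * Real.exp (-(1 / 2 * bdist n x.1 J)) := sum_le_sum hterm
    _ = (univ.filter (fun y : Fin n × Fin B => y.1 = J)).card
          * (4 * Real.exp 1 * Real.exp (-(1 / 2 * bdist n x.1 J))) := by rw [sum_const, nsmul_eq_mul]
    _ ≤ (B : ℝ) * (4 * Real.exp 1 * Real.exp (-(1 / 2 * bdist n x.1 J))) :=
        mul_le_mul_of_nonneg_right (by exact_mod_cast hcard) (by positivity)
    _ = _ := by ring

/-- THE `(M)`-FIELD SHAPE `m∂*G` (`MTwo.mDtG`), for the skeleton: at mass `1/B`, `∂*G₀ = ∂*(∂∂* + B⁻²)⁻¹ ∈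
𝒟(0, 1, 4e)` on the toy frame (`δ₀ ≤ 1/2`), with a `B`-, `n`-, `N`-free constant. [folklore] -/
theorem DtGd_opDec (hB : 0 < B) (hδ : δ₀ ≤ 1 / 2) :
    OpDec (toyFrame n B N hN δ₀) Prod.fst Prod.fst id id 0 1 (4 * Real.exp 1)
      (Dbw n B * Gd n B ((B : ℝ)⁻¹ ^ 2)) := by
  refine ⟨fun I J => 4 * Real.exp 1 * (B : ℝ) * Real.exp (-(δ₀ * bdist n I J)), ⟨?_, ?_⟩, ?_⟩
  · intro I J; positivity
  · intro x J
    refine (DtGd_block_rowsum hB x J).trans ?_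
    refine mul_le_mul_of_nonneg_left (Real.exp_le_exp.mpr ?_) (by positivity)
    nlinarith [bdist_nonneg (n := n) x.1 J]
  · intro I J
    simp only [toyFrame_ρ, toyFrame_sc, Frame.rate_zero, toyFrame_δ₀, id, zpow_one]
    rw [abs_of_nonneg (by positivity)]

end Block

/-! ## §4 The coarse-inverse engine: weighted diagonal dominance ⇒ decay of the inverse (no Neumann series) -/

section InvEngine

variable {α : Type*} [Fintype α] [DecidableEq α]

/-- a SUPERMULTIPLICATIVE WEIGHT: `w ≥ 1`, `w(i,i) = 1`, `w(i,k) ≤ w(i,j)·w(j,k)` — e.g. `e^{κ·d(i,j)}` for a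
pseudo-metric `d` and `κ ≥ 0` (`isWt_ewt`). OURS (typing). [folklore] -/
structure IsWt (w : α → α → ℝ) : Prop where
  /-- `w ≥ 1` -/
  one_le : ∀ i j, 1 ≤ w i j
  /-- `w(i,i) = 1` -/
  diag : ∀ i, w i i = 1
  /-- supermultiplicativity (the triangle inequality of `log w`) -/
  tri : ∀ i j k, w i k ≤ w i j * w j k

omit [Fintype α] [DecidableEq α] in
/-- [folklore] -/
theorem IsWt.nonneg {w : α → α → ℝ} (hw : IsWt w) (i j : α) : 0 ≤ w i j := le_trans zero_le_one (hw.one_le i j)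

/-- WEIGHTED ROW BOUND `Σ_j |M(i,j)|·w(i,j) ≤ q` for every row `i` (a bound on the weighted `ℓ^∞ → ℓ^∞`
operator norm). OURS (typing). [folklore] -/
def RowLe (w : α → α → ℝ) (M : Matrix α α ℝ) (q : ℝ) : Prop := ∀ i, ∑ j, |M i j| * w i j ≤ q

namespace RowLe

variable {w : α → α → ℝ} {M N : Matrix α α ℝ} {q r : ℝ}

omit [DecidableEq α] in
/-- a single weighted entry is below the row bound. [folklore] -/
theorem entry_mul_le (hw : IsWt w) (hM : RowLe w M q) (i j : α) : |M i j| * w i j ≤ q :=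
  le_trans (single_le_sum (fun k _ => mul_nonneg (abs_nonneg (M i k)) (hw.nonneg i k)) (mem_univ j)) (hM i)

omit [DecidableEq α] in
/-- plain row sums are below the weighted ones. [folklore] -/
theorem rowsum_le (hw : IsWt w) (hM : RowLe w M q) (i : α) : ∑ j, |M i j| ≤ q :=
  le_trans (sum_le_sum fun j _ => by
    simpa using mul_le_mul_of_nonneg_left (hw.one_le i j) (abs_nonneg (M i j))) (hM i)

omit [DecidableEq α] in
/-- `ℓ^∞` contraction by the row bound. [folklore] -/
theorem abs_mulVec_le (hw : IsWt w) (hM : RowLe w M q) {v : α → ℝ} {c : ℝ} (hv : ∀ j, |v j| ≤ c) (i : α) :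
    |M.mulVec v i| ≤ q * c := by
  have hc : 0 ≤ c := le_trans (abs_nonneg _) (hv i)
  calc |M.mulVec v i| = |∑ j, M i j * v j| := by simp only [Matrix.mulVec, dotProduct]
    _ ≤ ∑ j, |M i j * v j| := abs_sum_le_sum_abs _ _
    _ = ∑ j, |M i j| * |v j| := by simp_rw [abs_mul]
    _ ≤ ∑ j, |M i j| * c := sum_le_sum fun j _ => mul_le_mul_of_nonneg_left (hv j) (abs_nonneg _)
    _ = (∑ j, |M i j|) * c := by rw [Finset.sum_mul]
    _ ≤ q * c := mul_le_mul_of_nonneg_right (hM.rowsum_le hw i) hc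

omit [DecidableEq α] in
/-- SUBMULTIPLICATIVITY: weighted row bounds multiply. [folklore] -/
theorem mul (hw : IsWt w) (hM : RowLe w M q) (hN : RowLe w N r) (hr : 0 ≤ r) : RowLe w (M * N) (q * r) := by
  intro i
  calc ∑ k, |(M * N) i k| * w i k
      ≤ ∑ k, (∑ j, |M i j| * |N j k|) * w i k := by
        refine sum_le_sum fun k _ => mul_le_mul_of_nonneg_right ?_ (hw.nonneg i k)
        rw [Matrix.mul_apply]
        exact (abs_sum_le_sum_abs _ _).trans (le_of_eq (by simp_rw [abs_mul]))
    _ = ∑ k, ∑ j, |M i j| * (|N j k| * w i k) := by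
        refine sum_congr rfl fun k _ => ?_
        rw [Finset.sum_mul]
        exact sum_congr rfl fun j _ => by ring
    _ = ∑ j, ∑ k, |M i j| * (|N j k| * w i k) := Finset.sum_comm
    _ ≤ ∑ j, ∑ k, |M i j| * (|N j k| * (w i j * w j k)) := by
        refine sum_le_sum fun j _ => sum_le_sum fun k _ => ?_
        exact mul_le_mul_of_nonneg_left (mul_le_mul_of_nonneg_left (hw.tri i j k) (abs_nonneg _))
          (abs_nonneg _)
    _ = ∑ j, |M i j| * w i j * ∑ k, |N j k| * w j k := by
        refine sum_congr rfl fun j _ => ?_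
        rw [Finset.mul_sum]
        exact sum_congr rfl fun k _ => by ring
    _ ≤ ∑ j, |M i j| * w i j * r :=
        sum_le_sum fun j _ => mul_le_mul_of_nonneg_left (hN j) (mul_nonneg (abs_nonneg _) (hw.nonneg i j))
    _ = (∑ j, |M i j| * w i j) * r := by rw [Finset.sum_mul]
    _ ≤ q * r := mul_le_mul_of_nonneg_right (hM i) hr

/-- INJECTIVITY: `1 − M` is injective when the rows of `M` are `≤ q < 1` (look at a largest `|v|`). [folklore] -/
theorem one_sub_mulVec_injective (hw : IsWt w) (hM : RowLe w M q) (hq : q < 1) :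
    Function.Injective (1 - M).mulVec := by
  intro u v huv
  have hd : (1 - M).mulVec (u - v) = 0 := by rw [Matrix.mulVec_sub, huv, sub_self]
  have hfix : ∀ i, (u - v) i = M.mulVec (u - v) i := by
    intro i
    have h := congrFun hd i
    rw [Matrix.sub_mulVec, Pi.sub_apply, Matrix.one_mulVec, Pi.zero_apply, sub_eq_zero] at h
    exact h
  by_cases hα : (univ : Finset α).Nonempty
  · obtain ⟨i₀, -, hmax⟩ := exists_max_image univ (fun j => |(u - v) j|) hα
    have hmax' : ∀ j, |(u - v) j| ≤ |(u - v) i₀| := fun j => hmax j (mem_univ j)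
    have h1 := hM.abs_mulVec_le hw hmax' i₀
    rw [← hfix i₀] at h1
    have h0 : |(u - v) i₀| = 0 := by nlinarith [abs_nonneg ((u - v) i₀)]
    funext j
    have hj := hmax' j
    rw [h0] at hj
    have hj' : (u - v) j = 0 := abs_eq_zero.mp (le_antisymm hj (abs_nonneg _))
    rwa [Pi.sub_apply, sub_eq_zero] at hj'
  · funext j; exact absurd ⟨j, mem_univ j⟩ hα

/-- [folklore] -/
theorem isUnit_one_sub (hw : IsWt w) (hM : RowLe w M q) (hq : q < 1) : IsUnit (1 - M) :=
  Matrix.mulVec_injective_iff_isUnit.mp (hM.one_sub_mulVec_injective hw hq)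

/-- THE BOOTSTRAP: the weighted rows of `(1 − M)⁻¹` are `≤ (1 − q)⁻¹` — from the exact finite identity
`(1 − M)⁻¹ = 1 + M·(1 − M)⁻¹` read at a row where the weighted sum is largest; no Neumann series. [folklore] -/
theorem inv_one_sub (hw : IsWt w) (hM : RowLe w M q) (hq : q < 1) : RowLe w (1 - M)⁻¹ (1 - q)⁻¹ := by
  set X := (1 - M)⁻¹ with hXdef
  have hunit : IsUnit (1 - M).det := (Matrix.isUnit_iff_isUnit_det _).mp (hM.isUnit_one_sub hw hq)
  have hX : X = 1 + M * X := by
    have h := Matrix.mul_nonsing_inv (1 - M) hunit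
    rw [Matrix.sub_mul, Matrix.one_mul, sub_eq_iff_eq_add] at h
    exact h
  set s : α → ℝ := fun i => ∑ k, |X i k| * w i k with hsdef
  have hs0 : ∀ i, 0 ≤ s i := fun i => sum_nonneg fun k _ => mul_nonneg (abs_nonneg _) (hw.nonneg i k)
  have hstep : ∀ i, s i ≤ 1 + ∑ j, |M i j| * w i j * s j := by
    intro i
    calc s i = ∑ k, |X i k| * w i k := rfl
      _ ≤ ∑ k, ((if i = k then (1 : ℝ) else 0) + ∑ j, |M i j| * |X j k|) * w i k := by
          refine sum_le_sum fun k _ => mul_le_mul_of_nonneg_right ?_ (hw.nonneg i k)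
          have hik : X i k = (1 + M * X) i k := by rw [← hX]
          rw [hik, Matrix.add_apply, Matrix.one_apply, Matrix.mul_apply]
          refine (abs_add_le _ _).trans (add_le_add ?_ ?_)
          · split_ifs <;> simp
          · exact (abs_sum_le_sum_abs _ _).trans (le_of_eq (by simp_rw [abs_mul]))
      _ = ∑ k, (if i = k then (1 : ℝ) else 0) * w i k + ∑ k, (∑ j, |M i j| * |X j k|) * w i k := by
          rw [← sum_add_distrib]
          exact sum_congr rfl fun k _ => by ring
      _ = 1 + ∑ j, ∑ k, |M i j| * (|X j k| * w i k) := by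
          congr 1
          · simp only [ite_mul, one_mul, zero_mul, Finset.sum_ite_eq, mem_univ, if_true, hw.diag]
          · rw [Finset.sum_comm]
            refine sum_congr rfl fun k _ => ?_
            rw [Finset.sum_mul]
            exact sum_congr rfl fun j _ => by ring
      _ ≤ 1 + ∑ j, ∑ k, |M i j| * (|X j k| * (w i j * w j k)) := by
          refine add_le_add le_rfl (sum_le_sum fun j _ => sum_le_sum fun k _ => ?_)
          exact mul_le_mul_of_nonneg_left (mul_le_mul_of_nonneg_left (hw.tri i j k) (abs_nonneg _))
            (abs_nonneg _)
      _ = 1 + ∑ j, |M i j| * w i j * s j := by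
          congr 1
          refine sum_congr rfl fun j _ => ?_
          rw [Finset.mul_sum]
          exact sum_congr rfl fun k _ => by ring
  intro i
  by_cases hα : (univ : Finset α).Nonempty
  · obtain ⟨i₁, -, hmax⟩ := exists_max_image univ s hα
    have hmax' : ∀ j, s j ≤ s i₁ := fun j => hmax j (mem_univ j)
    have h1 : s i₁ ≤ 1 + q * s i₁ := by
      calc s i₁ ≤ 1 + ∑ j, |M i₁ j| * w i₁ j * s j := hstep i₁
        _ ≤ 1 + ∑ j, |M i₁ j| * w i₁ j * s i₁ :=
            add_le_add le_rfl (sum_le_sum fun j _ =>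
              mul_le_mul_of_nonneg_left (hmax' j) (mul_nonneg (abs_nonneg _) (hw.nonneg _ _)))
        _ = 1 + (∑ j, |M i₁ j| * w i₁ j) * s i₁ := by rw [Finset.sum_mul]
        _ ≤ 1 + q * s i₁ := add_le_add le_rfl (mul_le_mul_of_nonneg_right (hM i₁) (hs0 i₁))
    have h2 : s i₁ ≤ (1 - q)⁻¹ := by
      rw [← one_div, le_div_iff₀ (by linarith)]
      have : s i₁ * (1 - q) = s i₁ - q * s i₁ := by ring
      linarith
    exact (hmax' i).trans h2
  · exact absurd ⟨i, mem_univ i⟩ hα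

/-- THE ENGINE: if the weighted rows of `1 − D⁻¹E` are `≤ q < 1` for a diagonal `D ≥ d > 0`, then `E` is
invertible and the weighted rows of `E⁻¹` are `≤ (1 − q)⁻¹·d⁻¹`; with the weight `e^{κ·dist}` this is the
exponential decay `|E⁻¹(i,j)| ≤ e^{−κ·dist(i,j)}/((1 − q)d)` (`entry_mul_le`). [folklore] -/
theorem inv_of_diag (hw : IsWt w) {E : Matrix α α ℝ} {D : α → ℝ} {d : ℝ} (hd : 0 < d) (hD : ∀ i, d ≤ D i)
    (hq : q < 1) (hM : RowLe w (1 - Matrix.diagonal (fun i => (D i)⁻¹) * E) q) :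
    IsUnit E ∧ RowLe w E⁻¹ ((1 - q)⁻¹ * d⁻¹) := by
  set N := Matrix.diagonal (fun i => (D i)⁻¹) * E with hNdef
  have hMN : 1 - (1 - N) = N := sub_sub_cancel 1 N
  have hX := hM.inv_one_sub hw hq
  rw [hMN] at hX
  have hNu : IsUnit N.det := by
    have h := hM.isUnit_one_sub hw hq
    rw [hMN] at h
    exact (Matrix.isUnit_iff_isUnit_det _).mp h
  have hleft : (N⁻¹ * Matrix.diagonal (fun i => (D i)⁻¹)) * E = 1 := by
    rw [Matrix.mul_assoc, ← hNdef, Matrix.nonsing_inv_mul N hNu]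
  refine ⟨(Matrix.isUnit_iff_isUnit_det E).mpr (Matrix.isUnit_det_of_left_inverse hleft), ?_⟩
  rw [Matrix.inv_eq_left_inv hleft]
  intro i
  calc ∑ k, |(N⁻¹ * Matrix.diagonal (fun i => (D i)⁻¹)) i k| * w i k
      = ∑ k, |N⁻¹ i k| * w i k * (D k)⁻¹ := by
        refine sum_congr rfl fun k _ => ?_
        rw [Matrix.mul_diagonal, abs_mul, abs_of_pos (inv_pos.mpr (lt_of_lt_of_le hd (hD k)))]
        ring
    _ ≤ ∑ k, |N⁻¹ i k| * w i k * d⁻¹ := sum_le_sum fun k _ =>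
        mul_le_mul_of_nonneg_left (inv_anti₀ hd (hD k)) (mul_nonneg (abs_nonneg _) (hw.nonneg i k))
    _ = (∑ k, |N⁻¹ i k| * w i k) * d⁻¹ := by rw [Finset.sum_mul]
    _ ≤ (1 - q)⁻¹ * d⁻¹ := mul_le_mul_of_nonneg_right (hX i) (inv_nonneg.mpr hd.le)

end RowLe

end InvEngine

/-! ## §5 Coarse operators with unit blocks: from a weighted row bound to the class `𝒟(0, k, c)` -/

section Coarse

variable {n B : ℕ} {N : Finset (Fin n)} {hN : N.Nonempty} {δ₀ : ℝ}

/-- the exponential block weight `e^{κ|I−J|}` on the coarse toy lattice. OURS (typing). [folklore] -/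
def ewt (n : ℕ) (κ : ℝ) (I J : Fin n) : ℝ := Real.exp (κ * bdist n I J)

/-- [folklore] -/
theorem isWt_ewt {κ : ℝ} (hκ : 0 ≤ κ) : IsWt (ewt n κ) where
  one_le I J := Real.one_le_exp (mul_nonneg hκ (bdist_nonneg I J))
  diag I := by rw [ewt, bdist_self, mul_zero, Real.exp_zero]
  tri I J K := by
    rw [ewt, ewt, ewt, ← Real.exp_add]
    exact Real.exp_le_exp.mpr (by nlinarith [(bdist_isPseudoDist n).triangle I J K])

/-- a weighted row bound IS the `(M)`-class of a coarse operator with unit blocks: `Σ_J |C(I,J)|e^{κ|I−J|} ≤ R`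
with `0 ≤ δ₀ ≤ κ`... precisely `0 ≤ κ`, `δ₀ ≤ κ` and `R ≤ c·B^k` give `C ∈ 𝒟(0, k, c)` on the toy frame
(the target shape of the field `mC`, `k = −4`). [folklore] -/
theorem opDec_coarse_of_rowLe {C : Matrix (Fin n) (Fin n) ℝ} {κ R c : ℝ} {k : ℤ} (hκ0 : 0 ≤ κ) (hκ : δ₀ ≤ κ)
    (hC : RowLe (ewt n κ) C R) (hc : 0 ≤ c) (hR : R ≤ c * (B : ℝ) ^ k) :
    OpDec (toyFrame n B N hN δ₀) id id id id 0 k c C := by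
  refine ⟨fun I J => |C I J|, ⟨fun I J => abs_nonneg _, fun I J => ?_⟩, fun I J => ?_⟩
  · show ∑ x' ∈ univ.filter (fun x' => x' = J), |C I x'| ≤ |C I J|
    rw [Finset.filter_eq' univ J, if_pos (mem_univ J), sum_singleton]
  · simp only [toyFrame_ρ, toyFrame_sc, Frame.rate_zero, toyFrame_δ₀, id, abs_abs]
    have h1 : |C I J| * ewt n κ I J ≤ R := hC.entry_mul_le (isWt_ewt hκ0) I J
    have h2 : |C I J| ≤ R * Real.exp (-(κ * bdist n I J)) := by
      rw [Real.exp_neg, ← div_eq_mul_inv, le_div_iff₀ (Real.exp_pos _)]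
      exact h1
    calc |C I J| ≤ R * Real.exp (-(κ * bdist n I J)) := h2
      _ ≤ c * (B : ℝ) ^ k * Real.exp (-(κ * bdist n I J)) :=
          mul_le_mul_of_nonneg_right hR (Real.exp_nonneg _)
      _ ≤ c * (B : ℝ) ^ k * Real.exp (-(δ₀ * bdist n I J)) := by
          refine mul_le_mul_of_nonneg_left (Real.exp_le_exp.mpr ?_)
            (mul_nonneg hc (zpow_nonneg (Nat.cast_nonneg B) k))
          nlinarith [bdist_nonneg (n := n) I J]

end Coarse

/-! ## §6 The first LOWER bound: a block subsolution and the within-block mass of `G′` -/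

section LowerBound

variable {n B : ℕ} {μ t : ℝ}

/-- SUBSOLUTION COMPARISON (twin of `IsDomZ.inv_le_of_supersol`): for a dominant Z-matrix, `Aψ ≤ f`
entrywise forces `ψ ≤ A⁻¹f`. [folklore] -/
theorem _root_.Literature.MathematicalPhysics.QuantumFieldTheory.Balaban1983to89.B9SectCDiffCutModelToy5.IsDomZ.le_inv_mulVec_of_subsol
    {α : Type*} [Fintype α] [DecidableEq α] {A : Matrix α α ℝ} (hA : IsDomZ A) {ψ f : α → ℝ}
    (hψ : ∀ i, A.mulVec ψ i ≤ f i) (i : α) : ψ i ≤ A⁻¹.mulVec f i := by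
  have h := hA.nonneg_of_mulVec_nonneg (u := A⁻¹.mulVec f - ψ) (fun i' => by
    rw [Matrix.mulVec_sub, Pi.sub_apply, Matrix.mulVec_mulVec, hA.mul_inv, Matrix.one_mulVec, sub_nonneg]
    exact hψ i') i
  simpa only [Pi.sub_apply, sub_nonneg] using h

/-- the two boundary layers of a block: `E(o) = e^{−t·o} + e^{−t(B−1−o)}`. OURS. [folklore] -/
def bE (B : ℕ) (t o : ℝ) : ℝ := Real.exp (-(t * o)) + Real.exp (-(t * ((B : ℝ) - 1 - o)))

/-- the normalisation `Z = 1 + e^{−t(B−1)} = E(0) = E(B−1)`. OURS. [folklore] -/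
def bZ (B : ℕ) (t : ℝ) : ℝ := 1 + Real.exp (-(t * ((B : ℝ) - 1)))

/-- THE BLOCK PROFILE `θ(o) = 1 − E(o)/Z`: vanishes at both ends of the block, `0 ≤ θ ≤ 1` inside, and is an
`H_μ`-SUBsolution for the constant `μ` when `cosh t ≤ 1 + μ/2`. OURS. [folklore] -/
def bprof (B : ℕ) (t o : ℝ) : ℝ := 1 - bE B t o / bZ B t

/-- [folklore] -/
theorem bZ_pos : 0 < bZ B t := by unfold bZ; positivity

/-- [folklore] -/
theorem one_le_bZ : 1 ≤ bZ B t := by unfold bZ; linarith [Real.exp_nonneg (-(t * ((B : ℝ) - 1)))]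

/-- [folklore] -/
theorem bE_nonneg (o : ℝ) : 0 ≤ bE B t o := by unfold bE; positivity

/-- `θ(0) = 0`. [folklore] -/
theorem bprof_zero : bprof B t 0 = 0 := by
  unfold bprof bE bZ
  rw [mul_zero, neg_zero, Real.exp_zero, sub_zero, div_self (ne_of_gt (by positivity)), sub_self]

/-- `θ(B−1) = 0`. [folklore] -/
theorem bprof_last : bprof B t ((B : ℝ) - 1) = 0 := by
  unfold bprof bE bZ
  rw [sub_self, mul_zero, neg_zero, Real.exp_zero, add_comm, div_self (ne_of_gt (by positivity)), sub_self]

/-- `θ ≥ 0` on the block (`0 ≤ o ≤ B−1`, `t ≥ 0`): `E(o) ≤ Z` since `(1 − e^{−to})(1 − e^{−t(B−1−o)}) ≥ 0`. [folklore] -/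
theorem bprof_nonneg (ht : 0 ≤ t) {o : ℝ} (h0 : 0 ≤ o) (h1 : o ≤ (B : ℝ) - 1) : 0 ≤ bprof B t o := by
  unfold bprof
  rw [sub_nonneg, div_le_one bZ_pos]
  unfold bE bZ
  have hab : Real.exp (-(t * o)) * Real.exp (-(t * ((B : ℝ) - 1 - o))) = Real.exp (-(t * ((B : ℝ) - 1))) := by
    rw [← Real.exp_add]; congr 1; ring
  have ha1 : Real.exp (-(t * o)) ≤ 1 := Real.exp_le_one_iff.mpr (by nlinarith)
  have hb1 : Real.exp (-(t * ((B : ℝ) - 1 - o))) ≤ 1 := Real.exp_le_one_iff.mpr (by nlinarith)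
  nlinarith [mul_nonneg (sub_nonneg.mpr ha1) (sub_nonneg.mpr hb1)]

/-- `θ ≤ 1`. [folklore] -/
theorem bprof_le_one (o : ℝ) : bprof B t o ≤ 1 := by
  unfold bprof
  linarith [div_nonneg (bE_nonneg (B := B) (t := t) o) (bZ_pos (B := B) (t := t)).le]

/-- `θ ≥ 1 − E(o)` (as `Z ≥ 1`). [folklore] -/
theorem one_sub_bE_le_bprof (o : ℝ) : 1 - bE B t o ≤ bprof B t o := by
  unfold bprof
  linarith [div_le_self (bE_nonneg (B := B) (t := t) o) (one_le_bZ (B := B) (t := t))]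

/-- THE SUBSOLUTION PROPERTY of the profile: `(2+μ)θ(o) − θ(o−1) − θ(o+1) ≤ μ` for every real `o`, when
`e^t + e^{−t} ≤ 2 + μ` (from Toy5's `three_term_nonneg`). [folklore] -/
theorem bprof_three_term (hq : Real.exp t + Real.exp (-t) ≤ 2 + μ) (o : ℝ) :
    (2 + μ) * bprof B t o - bprof B t (o - 1) - bprof B t (o + 1) ≤ μ := by
  have h1 := three_term_nonneg hq (s := o) (s₁ := o - 1) (s₂ := o + 1) rfl rfl
  have h2 := three_term_nonneg' hq (s := (B : ℝ) - 1 - o) (s₁ := (B : ℝ) - 1 - (o - 1))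
    (s₂ := (B : ℝ) - 1 - (o + 1)) (by ring) (by ring)
  have key : (2 + μ) * bprof B t o - bprof B t (o - 1) - bprof B t (o + 1)
      = μ - ((2 + μ) * bE B t o - bE B t (o - 1) - bE B t (o + 1)) / bZ B t := by
    unfold bprof; ring
  rw [key]
  have hN : 0 ≤ (2 + μ) * bE B t o - bE B t (o - 1) - bE B t (o + 1) := by
    unfold bE; linarith
  linarith [div_nonneg hN (bZ_pos (B := B) (t := t)).le]

/-- THE BLOCK SUBSOLUTION `ψ_I := μ⁻¹·θ·𝟙_I`. OURS. [folklore] -/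
def psi (n B : ℕ) (μ t : ℝ) (I : Fin n) (x : Fin n × Fin B) : ℝ :=
  if x.1 = I then μ⁻¹ * bprof B t (x.2.val : ℝ) else 0

/-- [folklore] -/
theorem psi_nonneg (hμ : 0 ≤ μ) (ht : 0 ≤ t) (I : Fin n) (x : Fin n × Fin B) : 0 ≤ psi n B μ t I x := by
  unfold psi
  split_ifs
  · refine mul_nonneg (inv_nonneg.mpr hμ) (bprof_nonneg ht (Nat.cast_nonneg _) ?_)
    have := x.2.isLt
    have h1 : (x.2.val : ℝ) + 1 ≤ B := by exact_mod_cast this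
    linarith
  · exact le_rfl

/-- `ψ_I` IS A SUBSOLUTION FOR THE BLOCK INDICATOR: `H_μ ψ_I ≤ 𝟙_I` entrywise (interior rows: the profile's
three-term inequality; the two end rows of the block and all rows outside: `ψ_I = 0` there and the neighbour
terms enter with a minus sign). [folklore] -/
theorem Hm_mulVec_psi_le (hμ : 0 < μ) (ht : 0 ≤ t) (hq : Real.exp t + Real.exp (-t) ≤ 2 + μ) (I : Fin n)
    (x : Fin n × Fin B) :
    (Hm n B μ).mulVec (psi n B μ t I) x ≤ if x.1 = I then 1 else 0 := by
  have hψ0 : ∀ z, 0 ≤ psi n B μ t I z := fun z => psi_nonneg hμ.le ht I z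
  have hS1 : 0 ≤ ∑ z, Sh n B x z * psi n B μ t I z :=
    sum_nonneg fun z _ => mul_nonneg (Sh_nonneg x z) (hψ0 z)
  have hS2 : 0 ≤ ∑ z, psi n B μ t I z * Sh n B z x :=
    sum_nonneg fun z _ => mul_nonneg (hψ0 z) (Sh_nonneg z x)
  rw [Hm_mulVec]
  by_cases hI : x.1 = I
  · rw [if_pos hI]
    by_cases hint : 1 ≤ x.2.val ∧ x.2.val + 1 < B
    · obtain ⟨h1, h2⟩ := hint
      have hy : ι ((x.1, ⟨x.2.val + 1, h2⟩) : Fin n × Fin B) = ι x + 1 := by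
        simp only [ι_eq]; omega
      have hw : ι x = ι ((x.1, ⟨x.2.val - 1, by omega⟩) : Fin n × Fin B) + 1 := by
        simp only [ι_eq]; omega
      have hx0 : ι x ≠ 0 := by rw [ι_eq]; omega
      rw [sum_Sh_mul hy, sum_mul_Sh hw, if_neg hx0, zero_mul, sub_zero]
      have hψx : psi n B μ t I x = μ⁻¹ * bprof B t (x.2.val : ℝ) := by
        unfold psi; rw [if_pos hI]
      have hψy : psi n B μ t I (x.1, ⟨x.2.val + 1, h2⟩) = μ⁻¹ * bprof B t ((x.2.val : ℝ) + 1) := by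
        unfold psi; rw [if_pos hI]; simp only [Nat.cast_add, Nat.cast_one]
      have hψw : psi n B μ t I (x.1, ⟨x.2.val - 1, by omega⟩) = μ⁻¹ * bprof B t ((x.2.val : ℝ) - 1) := by
        unfold psi; rw [if_pos hI]; simp only [Nat.cast_sub h1, Nat.cast_one]
      rw [hψx, hψy, hψw]
      have h3 := bprof_three_term (B := B) hq (x.2.val : ℝ)
      calc (2 + μ) * (μ⁻¹ * bprof B t (x.2.val : ℝ)) - μ⁻¹ * bprof B t ((x.2.val : ℝ) + 1)
            - μ⁻¹ * bprof B t ((x.2.val : ℝ) - 1)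
          = μ⁻¹ * ((2 + μ) * bprof B t (x.2.val : ℝ) - bprof B t ((x.2.val : ℝ) - 1)
              - bprof B t ((x.2.val : ℝ) + 1)) := by ring
        _ ≤ μ⁻¹ * μ := mul_le_mul_of_nonneg_left h3 (inv_nonneg.mpr hμ.le)
        _ = 1 := inv_mul_cancel₀ hμ.ne'
    · have hψx : psi n B μ t I x = 0 := by
        have hx2 := x.2.isLt
        have h : x.2.val = 0 ∨ x.2.val = B - 1 := by omega
        unfold psi
        rw [if_pos hI]
        rcases h with h | h
        · rw [h, Nat.cast_zero, bprof_zero, mul_zero]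
        · rw [h, Nat.cast_sub (by omega : 1 ≤ B), Nat.cast_one, bprof_last, mul_zero]
      rw [hψx]
      linarith [hS1, hS2]
  · rw [if_neg hI]
    have hψx : psi n B μ t I x = 0 := by unfold psi; rw [if_neg hI]
    rw [hψx]
    linarith [hS1, hS2]

/-- THE POINTWISE LOWER BOUND: `(G′𝟙_I)(x) ≥ μ⁻¹·θ(o(x))` on the block `I` (and `≥ 0` elsewhere). [folklore] -/
theorem psi_le_Gr_block (hμ : 0 < μ) (ht : 0 ≤ t) (hq : Real.exp t + Real.exp (-t) ≤ 2 + μ) (I : Fin n)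
    (x : Fin n × Fin B) :
    psi n B μ t I x ≤ (Gr n B μ).mulVec (fun z => if z.1 = I then (1 : ℝ) else 0) x :=
  (isDomZ_Hm hμ).le_inv_mulVec_of_subsol (Hm_mulVec_psi_le hμ ht hq I) x

/-- block sums are sums over the offset. [folklore] -/
theorem sum_block (F : Fin n × Fin B → ℝ) (I : Fin n) :
    ∑ x ∈ univ.filter (fun x : Fin n × Fin B => x.1 = I), F x = ∑ o : Fin B, F (I, o) := by
  have h : univ.filter (fun x : Fin n × Fin B => x.1 = I) = univ.image (fun o : Fin B => ((I, o) : Fin n × Fin B)) := by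
    ext x
    simp only [mem_filter, mem_univ, true_and, mem_image]
    constructor
    · intro hx; exact ⟨x.2, by rw [← hx]⟩
    · rintro ⟨o, rfl⟩; rfl
  rw [h, sum_image (fun o _ o' _ hoo => (Prod.mk.injEq _ _ _ _).mp hoo |>.2)]

/-- a geometric sum. [folklore] -/
theorem sum_exp_neg_le (ht : 0 < t) : ∑ o : Fin B, Real.exp (-(t * (o.val : ℝ))) ≤ (1 - Real.exp (-t))⁻¹ := by
  have hr0 : 0 ≤ Real.exp (-t) := Real.exp_nonneg _
  have hr1 : Real.exp (-t) < 1 := by rw [← Real.exp_zero]; exact Real.exp_lt_exp.mpr (by linarith)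
  have h1 : ∑ o : Fin B, Real.exp (-(t * (o.val : ℝ))) = ∑ i ∈ range B, Real.exp (-t) ^ i := by
    rw [Fin.sum_univ_eq_sum_range (fun i => Real.exp (-(t * (i : ℝ)))) B]
    refine sum_congr rfl fun i _ => ?_
    rw [← Real.exp_nat_mul]; congr 1; ring
  rw [h1]
  have h2 := geom_sum_mul_neg (Real.exp (-t)) B
  have h3 : 0 < 1 - Real.exp (-t) := by linarith
  rw [← one_div, le_div_iff₀ h3, h2]
  linarith [pow_nonneg hr0 B]

/-- THE WITHIN-BLOCK MASS OF `G′` FROM BELOW: `Σ_{x,z ∈ I} G′(x,z) ≥ μ⁻¹·(B − 2/(1 − e^{−t}))` whenever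
`e^t + e^{−t} ≤ 2 + μ`, `t > 0` — for `μ = m²`, `t = m/2`, `m = a/B` this is `(B³/a²)(1 − O(1/a))`, the size
that makes the diagonal of `E = Q′G′²Q′*` dominate (route (α) of the header). [folklore] -/
theorem blockMass_ge (hμ : 0 < μ) (ht : 0 < t) (hq : Real.exp t + Real.exp (-t) ≤ 2 + μ) (I : Fin n) :
    μ⁻¹ * ((B : ℝ) - 2 * (1 - Real.exp (-t))⁻¹)
      ≤ ∑ x ∈ univ.filter (fun x : Fin n × Fin B => x.1 = I),
          (Gr n B μ).mulVec (fun z => if z.1 = I then (1 : ℝ) else 0) x := by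
  have h1 : ∑ x ∈ univ.filter (fun x : Fin n × Fin B => x.1 = I), psi n B μ t I x
      ≤ ∑ x ∈ univ.filter (fun x : Fin n × Fin B => x.1 = I),
          (Gr n B μ).mulVec (fun z => if z.1 = I then (1 : ℝ) else 0) x :=
    sum_le_sum fun x _ => psi_le_Gr_block hμ ht.le hq I x
  refine le_trans ?_ h1
  rw [sum_block]
  have h2 : ∀ o : Fin B, μ⁻¹ * (1 - bE B t (o.val : ℝ)) ≤ psi n B μ t I (I, o) := by
    intro o
    show μ⁻¹ * (1 - bE B t (o.val : ℝ))
      ≤ if ((I, o) : Fin n × Fin B).1 = I then μ⁻¹ * bprof B t (o.val : ℝ) else 0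
    rw [if_pos rfl]
    exact mul_le_mul_of_nonneg_left (one_sub_bE_le_bprof _) (inv_nonneg.mpr hμ.le)
  refine le_trans ?_ (sum_le_sum fun o _ => h2 o)
  rw [← Finset.mul_sum, Finset.sum_sub_distrib, Finset.sum_const, Finset.card_univ, Fintype.card_fin,
    nsmul_eq_mul, mul_one]
  refine mul_le_mul_of_nonneg_left ?_ (inv_nonneg.mpr hμ.le)
  have h3 : ∑ o : Fin B, bE B t (o.val : ℝ) ≤ 2 * (1 - Real.exp (-t))⁻¹ := by
    unfold bE
    rw [sum_add_distrib]
    have hrefl : ∑ o : Fin B, Real.exp (-(t * ((B : ℝ) - 1 - (o.val : ℝ))))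
        = ∑ o : Fin B, Real.exp (-(t * (o.val : ℝ))) := by
      rw [← Equiv.sum_comp Fin.revPerm (fun o : Fin B => Real.exp (-(t * (o.val : ℝ))))]
      refine sum_congr rfl fun o _ => ?_
      have ho := o.isLt
      rw [Fin.revPerm_apply, Fin.val_rev, Nat.cast_sub (by omega : o.val + 1 ≤ B)]
      push_cast
      ring_nf
    rw [hrefl, two_mul]
    exact add_le_add (sum_exp_neg_le ht) (sum_exp_neg_le ht)
  linarith

end LowerBound

/-! ## §7 The coarse operator `E₂ = Q′G′²Q′*` and its diagonal from below -/

section CoarseOp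

variable {n B : ℕ} {μ t : ℝ}

/-- THE COARSE OPERATOR `E₂ := Q′·G′²·Q′*` of the toy (block averaging `Qp`, block indicator `Qpt`); the sequence
datum `C` of the cut model is `E₂⁻¹`. OURS (typing). [folklore] -/
def E2 (n B : ℕ) (μ : ℝ) : Matrix (Fin n) (Fin n) ℝ := Qp n B * (Gr n B μ * Gr n B μ) * Qpt n B

/-- `Gr` is symmetric, pointwise. [folklore] -/
theorem Gr_symm (μ : ℝ) (x y : Fin n × Fin B) : Gr n B μ x y = Gr n B μ y x := by
  have h := congrFun (congrFun (Gr_transpose (n := n) (B := B) μ) x) y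
  rw [Matrix.transpose_apply] at h
  exact h.symm

/-- the entries of `E₂`: `E₂(I,J) = B⁻¹·Σ_{x∈I}Σ_{z∈J}(G′²)(x,z)`. [folklore] -/
theorem E2_apply (I J : Fin n) :
    E2 n B μ I J = (B : ℝ)⁻¹ * ∑ x ∈ univ.filter (fun x : Fin n × Fin B => x.1 = I),
      ∑ z ∈ univ.filter (fun z : Fin n × Fin B => z.1 = J), (Gr n B μ * Gr n B μ) x z := by
  unfold E2
  rw [Matrix.mul_apply]
  have h1 : ∀ z, (Qp n B * (Gr n B μ * Gr n B μ)) I z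
      = (B : ℝ)⁻¹ * ∑ x ∈ univ.filter (fun x : Fin n × Fin B => x.1 = I), (Gr n B μ * Gr n B μ) x z := by
    intro z
    rw [Matrix.mul_apply, Finset.sum_filter, Finset.mul_sum]
    refine sum_congr rfl fun x _ => ?_
    unfold Qp
    split_ifs <;> simp
  simp_rw [h1]
  have h2 : ∀ z, Qpt n B z J = if z.1 = J then (1 : ℝ) else 0 := fun z => rfl
  simp_rw [h2, mul_ite, mul_one, mul_zero]
  rw [← Finset.sum_filter, ← Finset.mul_sum, Finset.sum_comm]

/-- `(G′²)(x,z) ≥ Σ_{w∈I} G′(x,w)G′(w,z)` (drop the non-negative terms `w ∉ I`). [folklore] -/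
theorem GrGr_ge_block (hμ : 0 < μ) (I : Fin n) (x z : Fin n × Fin B) :
    ∑ w ∈ univ.filter (fun w : Fin n × Fin B => w.1 = I), Gr n B μ x w * Gr n B μ w z
      ≤ (Gr n B μ * Gr n B μ) x z := by
  rw [Matrix.mul_apply]
  exact sum_le_sum_of_subset_of_nonneg (filter_subset _ _)
    fun w _ _ => mul_nonneg (Gr_nonneg hμ x w) (Gr_nonneg hμ w z)

/-- THE DIAGONAL OF `E₂` FROM BELOW, structural form: `E₂(I,I) ≥ (Σ_{x∈I}(G′𝟙_I)(x))²/B²` (drop `w ∉ I`, symmetry,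
Cauchy–Schwarz over the `B` sites of the block). [folklore] -/
theorem E2_diag_ge_sq (hB : 0 < B) (hμ : 0 < μ) (I : Fin n) :
    (∑ x ∈ univ.filter (fun x : Fin n × Fin B => x.1 = I),
        (Gr n B μ).mulVec (fun z => if z.1 = I then (1 : ℝ) else 0) x) ^ 2 / (B : ℝ) ^ 2
      ≤ E2 n B μ I I := by
  set s := univ.filter (fun x : Fin n × Fin B => x.1 = I) with hs
  set c : Fin n × Fin B → ℝ := fun w => ∑ z ∈ s, Gr n B μ w z with hc
  have hBr : (0 : ℝ) < B := by exact_mod_cast hB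
  -- the row sums `c w = (G′𝟙_I)(w)`
  have hcv : ∀ w, (Gr n B μ).mulVec (fun z => if z.1 = I then (1 : ℝ) else 0) w = c w := by
    intro w
    simp only [Matrix.mulVec, dotProduct, mul_ite, mul_one, mul_zero]
    rw [← Finset.sum_filter]
  simp_rw [hcv]
  -- step 1: E₂(I,I) ≥ B⁻¹ Σ_{w∈I} c_w²
  have h1 : (B : ℝ)⁻¹ * ∑ w ∈ s, c w ^ 2 ≤ E2 n B μ I I := by
    rw [E2_apply]
    refine mul_le_mul_of_nonneg_left ?_ (inv_nonneg.mpr hBr.le)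
    calc ∑ w ∈ s, c w ^ 2 = ∑ w ∈ s, (∑ x ∈ s, Gr n B μ x w) * (∑ z ∈ s, Gr n B μ w z) := by
          refine sum_congr rfl fun w _ => ?_
          rw [sq]
          congr 1
          exact sum_congr rfl fun x _ => Gr_symm μ w x
      _ = ∑ w ∈ s, ∑ x ∈ s, ∑ z ∈ s, Gr n B μ x w * Gr n B μ w z := by
          refine sum_congr rfl fun w _ => ?_
          rw [Finset.sum_mul_sum]
      _ = ∑ x ∈ s, ∑ z ∈ s, ∑ w ∈ s, Gr n B μ x w * Gr n B μ w z := by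
          rw [Finset.sum_comm]
          refine sum_congr rfl fun x _ => ?_
          rw [Finset.sum_comm]
      _ ≤ ∑ x ∈ s, ∑ z ∈ s, (Gr n B μ * Gr n B μ) x z :=
          sum_le_sum fun x _ => sum_le_sum fun z _ => GrGr_ge_block hμ I x z
  -- step 2: Cauchy–Schwarz  (Σ c)² ≤ #s Σ c² ≤ B Σ c²
  have h2 : (∑ w ∈ s, c w) ^ 2 ≤ (B : ℝ) * ∑ w ∈ s, c w ^ 2 := by
    refine (sq_sum_le_card_mul_sum_sq (s := s) (f := c)).trans ?_
    exact mul_le_mul_of_nonneg_right (by exact_mod_cast card_block_le (B := B) I)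
      (sum_nonneg fun w _ => sq_nonneg _)
  calc (∑ w ∈ s, c w) ^ 2 / (B : ℝ) ^ 2 ≤ (B : ℝ) * (∑ w ∈ s, c w ^ 2) / (B : ℝ) ^ 2 :=
        div_le_div_of_nonneg_right h2 (sq_nonneg _)
    _ = (B : ℝ)⁻¹ * ∑ w ∈ s, c w ^ 2 := by field_simp
    _ ≤ E2 n B μ I I := h1

/-- THE DIAGONAL OF `E₂` FROM BELOW, quantitative form: with `e^t + e^{−t} ≤ 2 + μ`, `t > 0` and
`B ≥ 2/(1 − e^{−t})`, `E₂(I,I) ≥ μ⁻²(B − 2/(1 − e^{−t}))²/B²` — at `μ = (a/B)²`, `t = a/(2B)`: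
`≳ (B⁴/a⁴)(1 − 8/a)²`, the size against which the off-diagonal row mass `O(B⁴/a⁵)` is to be measured (census N12). [folklore] -/
theorem E2_diag_ge (hB : 0 < B) (hμ : 0 < μ) (ht : 0 < t) (hq : Real.exp t + Real.exp (-t) ≤ 2 + μ)
    (hL : 0 ≤ (B : ℝ) - 2 * (1 - Real.exp (-t))⁻¹) (I : Fin n) :
    (μ⁻¹ * ((B : ℝ) - 2 * (1 - Real.exp (-t))⁻¹)) ^ 2 / (B : ℝ) ^ 2 ≤ E2 n B μ I I := by
  refine le_trans ?_ (E2_diag_ge_sq hB hμ I)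
  refine div_le_div_of_nonneg_right ?_ (sq_nonneg _)
  exact pow_le_pow_left₀ (mul_nonneg (inv_nonneg.mpr hμ.le) hL) (blockMass_ge hμ ht hq I) 2

end CoarseOp

end

end Literature.MathematicalPhysics.QuantumFieldTheory.Balaban1983to89.B9SectCDiffCutModelToy6
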